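import Summits.QuantumFields.QCD.Theses.HeatSlicedQuarks

/-!
# Impact of the summit statement re-type p117723 (2026-08-16T17:37Z) on the crux
`HeatSlicedQuarks.RobustYangMillsHandover := ContinuumQCDExists → QCD` (stmt-QuantumFields-8892)

`QCDOf Nf` now conjoins `reg.IsChiralAtZero` (the flavour-blind offset of `m_crit` is pinned to the chiral
point: for every `ε > 0` some POSITIVE mass tuple has no uniform lattice gap `ε`).  Kernel-checked here,
importing ONLY the route module (no Theorems olean that predates the re-type):

* `qcdOf_iff_chiral` — the new shape (`Iff.rfl`);
* `qcdOf_gapProfile` — the conclusion now entails, for ONE regularisation, a lattice gap at EVERY positive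
  mass tuple AND arbitrarily small gaps at positive tuples (`inf_{m>0} Δ_max(m) = 0`): light-quark content;
* `QCDOfAboveThreshold` — the OLD threshold form (the RHS of the pre-re-type `qcdOf_iff_threshold`), which is
  what every heavy-threshold handover line on this crux delivers (`∃ M₀`, gaps above it), and
  `qcdOf_imp_aboveThreshold` — the surviving direction.  The converse (`qcdOf_iff_threshold.mpr`, used by the
  head composition `RobustYangMillsHandover_of` of ALL five `Lines/*.lean` and by Disproof §5/§8) is no longer
  a theorem: the shifted regularisation `m_crit + a M₀/Z_m` is gapped at all its positive masses and is
  therefore NOT `IsChiralAtZero` unless `M₀` is the chiral offset itself.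
* `handover_iff` — the crux still unfolds to `ContinuumQCDExists → QCD`; with the new `QCD` it asks, from
  X₀'s regularisation (offset unpinned, no gap data), for a chiral-pinned regularisation gapped at ALL
  positive masses: the light-quark regime is now INSIDE the crux.
-/

namespace Summit.QuantumFields.QCD.Cruxes.RobustYangMillsHandover.Retype

open Summit.QuantumFields.QCD.Theses.HeatSlicedQuarks (ContinuumQCDExists RobustYangMillsHandover)
open Literature.MathematicalPhysics.QuantumFieldTheory

/-- The re-typed conjunct, unfolded (definitional). [folklore] -/
theorem qcdOf_iff_chiral (Nf : ℕ) :
    QCDOf Nf ↔ ∃ reg : QCDRegularisation Nf, reg.HasMassScaling ∧ reg.IsChiralAtZero ∧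
      ∀ m : Fin Nf → ℝ, (∀ f, 0 < m f) →
        ∃ (z shift : QCDField Nf → ℕ → ℝ) (T : OSData (QCDField Nf) 4),
          IsQCDAlong (reg.scheme m z shift) T ∧ T.IsNontrivial QCDField.glue ∧
            T.IsNonGaussian QCDField.glue ∧
              (∀ f g : Fin Nf, f ≠ g → T.IsNontrivial (QCDField.pseudoRe f g)) ∧
                ∃ Δ > 0, T.HasMassGap Δ ∧ (reg.scheme m z shift).HasLatticeMassGap Δ :=
  Iff.rfl

/-- **Gap profile forced by the re-typed conjunct**: one regularisation whose lattice theory is gapped at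
EVERY positive mass tuple and has NO uniform gap `ε` at some positive tuple, for every `ε > 0`
(`HasLatticeMassGap` does not read `z, shift`: `reg.scheme m z shift` and `reg.scheme m 0 0` have the same
`β, mq, L, a`). [folklore] -/
theorem qcdOf_gapProfile (Nf : ℕ) (h : QCDOf Nf) :
    ∃ reg : QCDRegularisation Nf,
      (∀ m : Fin Nf → ℝ, (∀ f, 0 < m f) → ∃ Δ > 0, (reg.scheme m 0 0).HasLatticeMassGap Δ) ∧
      ∀ ε > (0 : ℝ), ∃ m : Fin Nf → ℝ, (∀ f, 0 < m f) ∧ ¬ (reg.scheme m 0 0).HasLatticeMassGap ε := by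
  obtain ⟨reg, -, hchi, hall⟩ := h
  refine ⟨reg, fun m hm => ?_, hchi⟩
  obtain ⟨z, shift, T, -, -, -, -, Δ, hΔ, -, hL⟩ := hall m hm
  exact ⟨Δ, hΔ, hL⟩

/-- **The pre-re-type threshold form of the conjunct** (the RHS of the former `qcdOf_iff_threshold`): gaps
and honest data above an unpinned common offset `M₀ ≥ 0`.  This is the strongest statement a heavy-quark
handover can reach. [folklore] -/
def QCDOfAboveThreshold (Nf : ℕ) : Prop :=
  ∃ M₀ : ℝ, 0 ≤ M₀ ∧ ∃ reg : QCDRegularisation Nf,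
    reg.HasMassScaling ∧ ∀ m : Fin Nf → ℝ, (∀ f, M₀ < m f) →
      ∃ (z shift : QCDField Nf → ℕ → ℝ) (T : OSData (QCDField Nf) 4),
        IsQCDAlong (reg.scheme m z shift) T ∧ T.IsNontrivial QCDField.glue ∧ T.IsNonGaussian QCDField.glue ∧
          (∀ f g : Fin Nf, f ≠ g → T.IsNontrivial (QCDField.pseudoRe f g)) ∧
            ∃ Δ > 0, T.HasMassGap Δ ∧ (reg.scheme m z shift).HasLatticeMassGap Δ

/-- The surviving direction: the re-typed conjunct implies its threshold form (`M₀ = 0`). [folklore] -/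
theorem qcdOf_imp_aboveThreshold (Nf : ℕ) : QCDOf Nf → QCDOfAboveThreshold Nf := by
  rintro ⟨reg, hMS, -, h⟩
  exact ⟨0, le_rfl, reg, hMS, h⟩

/-- The crux still unfolds to the bare arrow (definitional); its consequent is the RE-TYPED `QCD`. [folklore] -/
theorem handover_iff : RobustYangMillsHandover ↔ (ContinuumQCDExists → QCDOf 2 ∧ QCDOf 3) := Iff.rfl

/-- What the antecedent X₀ supplies for one `N_f`: a regularisation with mass scaling and honest continuum
data at all positive masses — no lattice-gap datum and no chirality clause (definitional). [folklore] -/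
theorem continuumQCDExists_iff :
    ContinuumQCDExists ↔ ∀ Nf : ℕ, Nf = 2 ∨ Nf = 3 → ∃ reg : QCDRegularisation Nf, reg.HasMassScaling ∧
      ∀ m : Fin Nf → ℝ, (∀ f, 0 < m f) →
        ∃ (z shift : QCDField Nf → ℕ → ℝ) (T : OSData (QCDField Nf) 4),
          IsQCDAlong (reg.scheme m z shift) T ∧ T.IsNontrivial QCDField.glue ∧
            T.IsNonGaussian QCDField.glue ∧ ∀ f g : Fin Nf, f ≠ g → T.IsNontrivial (QCDField.pseudoRe f g) :=
  Iff.rfl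

/-! ## Rev 2 — restatement material for the planner (kernel-checked, route module only)

`QCDOfAtZeroOffset` is the PRE-re-type body of `QCDOf` verbatim; `qcdOfAboveThreshold_iff_atZeroOffset` re-proves the
former `qcdOf_iff_threshold` for it (shift `m_crit` by `a M₀ / Z_m`; the shift touches neither `HasMassScaling` nor the
scheme at the shifted masses), so the proposed restated target `HeavyHandover := ContinuumQCDExists →
QCDOfAboveThreshold 2 ∧ QCDOfAboveThreshold 3` is LITERALLY the pre-re-type crux, and `ChiralCompletion` is exactly
what the re-type added; `assembly_of_split` recovers the route's arrow `ContinuumQCDExists → QCD` from the two. -/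

/-- The pre-re-type body of the conjunct (no chirality clause, offset `0`). [folklore] -/
def QCDOfAtZeroOffset (Nf : ℕ) : Prop :=
  ∃ reg : QCDRegularisation Nf, reg.HasMassScaling ∧ ∀ m : Fin Nf → ℝ, (∀ f, 0 < m f) →
    ∃ (z shift : QCDField Nf → ℕ → ℝ) (T : OSData (QCDField Nf) 4),
      IsQCDAlong (reg.scheme m z shift) T ∧ T.IsNontrivial QCDField.glue ∧ T.IsNonGaussian QCDField.glue ∧
        (∀ f g : Fin Nf, f ≠ g → T.IsNontrivial (QCDField.pseudoRe f g)) ∧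
          ∃ Δ > 0, T.HasMassGap Δ ∧ (reg.scheme m z shift).HasLatticeMassGap Δ

/-- Shifting the critical mass by `a_k M₀ / Z_m(k)` realises the renormalised masses `M₀ + m_f` of the unshifted
regularisation (re-proof of the former `scheme_mcrit_shift`). [folklore] -/
theorem scheme_mcrit_shift' {Nf : ℕ} (reg : QCDRegularisation Nf) (M₀ : ℝ) (m : Fin Nf → ℝ)
    (z shift : QCDField Nf → ℕ → ℝ) :
    ({ reg with mcrit := fun k => reg.mcrit k + reg.a k * M₀ / reg.Zm k } : QCDRegularisation Nf).scheme m z shift =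
      reg.scheme (fun f => M₀ + m f) z shift := by
  simp only [QCDRegularisation.scheme, QCDScheme.mk.injEq, true_and, and_true]
  funext f k
  ring

/-- **The threshold form IS the pre-re-type conjunct** (re-proof of the former `qcdOf_iff_threshold`, now stated for
`QCDOfAtZeroOffset`): the `m_crit` shift is available exactly because no clause pins the offset. [folklore] -/
theorem qcdOfAboveThreshold_iff_atZeroOffset (Nf : ℕ) : QCDOfAboveThreshold Nf ↔ QCDOfAtZeroOffset Nf := by
  constructor
  · rintro ⟨M₀, -, reg, hMS, h⟩
    refine ⟨{ reg with mcrit := fun k => reg.mcrit k + reg.a k * M₀ / reg.Zm k }, hMS, fun m hm => ?_⟩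
    obtain ⟨z, shift, T, hQ, hN, hG, hP, Δ, hΔ, hT, hL⟩ :=
      h (fun f => M₀ + m f) (fun f => by linarith [hm f])
    refine ⟨z, shift, T, ?_, hN, hG, hP, Δ, hΔ, hT, ?_⟩
    · rwa [scheme_mcrit_shift']
    · rwa [scheme_mcrit_shift']
  · rintro ⟨reg, hMS, h⟩
    exact ⟨0, le_rfl, reg, hMS, h⟩

/-- Proposed restated target of this crux (= the pre-re-type crux, by `qcdOfAboveThreshold_iff_atZeroOffset`):
the heavy-quark handover. [folklore] -/
def HeavyHandover : Prop :=
  ContinuumQCDExists → QCDOfAboveThreshold 2 ∧ QCDOfAboveThreshold 3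

/-- Proposed new crux: the light-quark / chiral completion the re-type added. [folklore] -/
def ChiralCompletion : Prop :=
  QCDOfAboveThreshold 2 ∧ QCDOfAboveThreshold 3 → QCDOf 2 ∧ QCDOf 3

/-- The route's arrow is recovered from the split (pure logic). [folklore] -/
theorem assembly_of_split (h₁ : HeavyHandover) (h₂ : ChiralCompletion) : RobustYangMillsHandover :=
  fun hX => h₂ (h₁ hX)

/-- Conversely the re-typed crux gives the heavy handover outright (`qcdOf_imp_aboveThreshold`), so the split loses
nothing: `RobustYangMillsHandover ↔ HeavyHandover ∧ (ContinuumQCDExists → ChiralCompletion)`. [folklore] -/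
theorem handover_iff_split :
    RobustYangMillsHandover ↔ HeavyHandover ∧ (ContinuumQCDExists → ChiralCompletion) := by
  constructor
  · intro h
    exact ⟨fun hX => ⟨qcdOf_imp_aboveThreshold 2 (h hX).1, qcdOf_imp_aboveThreshold 3 (h hX).2⟩,
      fun hX _ => h hX⟩
  · rintro ⟨h₁, h₂⟩ hX
    exact h₂ hX (h₁ hX)

end Summit.QuantumFields.QCD.Cruxes.RobustYangMillsHandover.Retype
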